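import Mathlib
import Summits.Ventures.PercRepro2.HCov
import Summits.Ventures.PercRepro2.Graph
import Summits.Ventures.PercRepro2.RestrictClosure
import Summits.Ventures.PercRepro2.RECMReduction
import Summits.Ventures.PercRepro2.CutVertexPaths
import Summits.Ventures.PercRepro2.GcSkelRules
import Summits.Ventures.PercRepro2.GcSkelReduction
import Summits.Ventures.PercRepro2.GcSkelReductionI
import Summits.Ventures.PercRepro2.GcSkelCutShape
import Summits.Ventures.PercRepro2.GcSkelCutShapeMain

/-!
# The residual is two-connected off the leaf `a₃` (blind cell PercRepro2, typer-1 g53)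

The one open shape (`cutVertex_shape_of_wredI`) in the language of vertex deletion: on the
weighted residual `WRed.WReducedI`, for EVERY vertex `v`, any two non-isolated vertices `x, y`
other than `v` and `a₃` are connected in `G − v` (`SepPair.sepConfig ends {v}`: the edges not
touching `v` open) — **`conn_sepConfig_of_wredI`**; and on the cores (`a₃` not a leaf) the same
holds for `x, y` any non-isolated vertices other than `v` — **`conn_sepConfig_of_core`**: the
two-connected cores are two-connected in Whitney's sense on their edge-carrying part.

Proof: if `x` and `y` were not connected in `G − v`, then `v` would be a cut vertex between the
component `K` of `x` in `G − v` and the rest (`cutVertex_sepConfig`, from mine-2's (F1)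
`SepPair.endpoints_mem_of_mem_touches_cluster`), with `x`'s non-loop edge on the left and `y`'s on
the right; the one open shape makes the only non-loop edge of one side `{a₃, v}`, so `x = a₃` or
`y = a₃`; on the cores there is no such cut at all (`no_cutVertex_of_wredI_of_a3_not_leaf`).
-/

namespace Summit.Ventures.PercRepro2

open CovForm RECM CutVertexM9 SepPair

namespace WRed

section Cut

variable {V : Type*} {E : Type*}

/-- An edge with an end in the component `K` of `x` in `G − v` (`x ≠ v`) has all its ends in
`K ∪ {v}`. -/
lemma ends_mem_of_mem_cluster_sepConfig {ends : E → Sym2 V} {v x : V} (hxv : x ≠ v) {e : E}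
    {z : V} (hz : z ∈ ends e) (hzK : z ∈ cluster ends (sepConfig ends {v}) x) :
    ∀ w ∈ ends e, w ∈ cluster ends (sepConfig ends {v}) x ∪ {v} := by
  obtain ⟨y, hy⟩ := Sym2.mem_iff_exists.mp hz
  have hxv' : x ∉ ({v} : Set V) := by simpa using hxv
  have he : e ∈ touches ends (cluster ends (sepConfig ends {v}) x) := ⟨z, hzK, y, hy⟩
  have hboth := endpoints_mem_of_mem_touches_cluster hxv' he hy
  intro w hw
  rw [hy] at hw
  rcases Sym2.mem_iff.mp hw with rfl | rfl
  · exact hboth.1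
  · exact hboth.2

/-- **The cut at `v` between the component of `x` in `G − v` and the rest**: with `K` that
component and `side` marking the edges with all ends in `K ∪ {v}`, `v` is a cut vertex between
`K` and `(K ∪ {v})ᶜ`. -/
lemma cutVertex_sepConfig (ends : E → Sym2 V) {v x : V} (hxv : x ≠ v) (side : E → Bool)
    (hside : ∀ e, side e = true ↔ ∀ z ∈ ends e, z ∈ cluster ends (sepConfig ends {v}) x ∪ {v}) :
    CutVertex ends side (cluster ends (sepConfig ends {v}) x) v
      (cluster ends (sepConfig ends {v}) x ∪ {v})ᶜ where
  left := by
    intro e he z hz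
    rcases (hside e).1 he z hz with hK | hv
    · exact Or.inl hK
    · exact Or.inr (by simpa using hv)
  right := by
    intro e he z hz
    by_cases hzK : z ∈ cluster ends (sepConfig ends {v}) x
    · exfalso
      have : side e = true := (hside e).2 (ends_mem_of_mem_cluster_sepConfig hxv hz hzK)
      simp [this] at he
    · by_cases hzv : z = v
      · exact Or.inr hzv
      · left
        simp only [Set.mem_compl_iff, Set.mem_union, Set.mem_singleton_iff, not_or]
        exact ⟨hzK, hzv⟩
  disj := fun z hz hz' => hz' (Or.inl hz)
  vL := fun hv => not_mem_of_conn_sepConfig (A := {v}) (by simpa using hxv) hv rfl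
  vR := fun hv => hv (Or.inr rfl)

/-- **A non-connection in `G − v` gives a cut at `v`** with a non-loop edge of `x` on the left
and a non-loop edge of `y` on the right. -/
lemma exists_cut_of_not_conn_sepConfig (ends : E → Sym2 V) {v x y : V} (hxv : x ≠ v)
    (hyv : y ≠ v) (hx : ∃ e, x ∈ ends e ∧ ¬ (ends e).IsDiag)
    (hy : ∃ e, y ∈ ends e ∧ ¬ (ends e).IsDiag) (hxy : ¬ Conn ends (sepConfig ends {v}) x y) :
    ∃ side : E → Bool,
      CutVertex ends side (cluster ends (sepConfig ends {v}) x) v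
        (cluster ends (sepConfig ends {v}) x ∪ {v})ᶜ ∧
      (∃ g, side g = true ∧ ¬ (ends g).IsDiag ∧ x ∈ ends g) ∧
      (∃ g, side g = false ∧ ¬ (ends g).IsDiag ∧ y ∈ ends g) := by
  classical
  let side : E → Bool :=
    fun e => decide (∀ z ∈ ends e, z ∈ cluster ends (sepConfig ends {v}) x ∪ {v})
  have hside : ∀ e, side e = true ↔ ∀ z ∈ ends e, z ∈ cluster ends (sepConfig ends {v}) x ∪ {v} :=
    fun e => decide_eq_true_iff
  refine ⟨side, cutVertex_sepConfig ends hxv side hside, ?_, ?_⟩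
  · obtain ⟨ex, hxe, hxd⟩ := hx
    exact ⟨ex, (hside ex).2 (ends_mem_of_mem_cluster_sepConfig hxv hxe
      (mem_cluster_self ends (sepConfig ends {v}) x)), hxd, hxe⟩
  · obtain ⟨ey, hye, hyd⟩ := hy
    refine ⟨ey, ?_, hyd, hye⟩
    have hyK : y ∉ cluster ends (sepConfig ends {v}) x ∪ {v} := by
      simp only [Set.mem_union, mem_cluster, Set.mem_singleton_iff, not_or]
      exact ⟨hxy, hyv⟩
    cases hs : side ey with
    | true => exact absurd ((hside ey).1 hs y hye) hyK
    | false => rfl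

end Cut

section Main

variable {V : Type*} {E : Type*} [Fintype E] [DecidableEq V]
variable {ends : E → Sym2 V} {o a₁ a₂ a₃ b : V}

/-- **THE RESIDUAL IS TWO-CONNECTED OFF THE LEAF `a₃`**: on `WReducedI`, for every vertex `v`, two
non-isolated vertices other than `v` and `a₃` are connected in `G − v`. -/
theorem conn_sepConfig_of_wredI (h : WReducedI ends o a₁ a₂ a₃ b)
    (h12 : a₁ ≠ a₂) (h13 : a₁ ≠ a₃) (h23 : a₂ ≠ a₃) (ho1 : o ≠ a₁) (ho2 : o ≠ a₂) (ho3 : o ≠ a₃)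
    (hob : o ≠ b) (hb1 : b ≠ a₁) (hb2 : b ≠ a₂) (hb3 : b ≠ a₃) {v x y : V} (hxv : x ≠ v)
    (hyv : y ≠ v) (hx3 : x ≠ a₃) (hy3 : y ≠ a₃) (hx : ∃ e, x ∈ ends e ∧ ¬ (ends e).IsDiag)
    (hy : ∃ e, y ∈ ends e ∧ ¬ (ends e).IsDiag) : Conn ends (sepConfig ends {v}) x y := by
  by_contra hxy
  obtain ⟨side, hcut, ⟨ex, hsx, hxd, hxe⟩, ⟨ey, hsy, hyd, hye⟩⟩ :=
    exists_cut_of_not_conn_sepConfig ends hxv hyv hx hy hxy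
  rcases cutVertex_shape_of_wredI h hcut ⟨ex, hsx, hxd⟩ ⟨ey, hsy, hyd⟩ h12 h13 h23 ho1 ho2 ho3 hob
    hb1 hb2 hb3 with hs | hs
  · -- the only non-loop left edge is `{a₃, v}`, and `x`'s edge is a left edge
    obtain ⟨e₀, he₀, huniq⟩ := hs.edge
    have hex : ex = e₀ := huniq ex hsx hxd
    rw [hex, he₀] at hxe
    rcases Sym2.mem_iff.mp hxe with h' | h'
    · exact hx3 h'
    · exact hxv h'
  · -- the only non-loop right edge is `{a₃, v}`, and `y`'s edge is a right edge
    obtain ⟨e₀, he₀, huniq⟩ := hs.edge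
    have hey : ey = e₀ := huniq ey (by simp [hsy]) hyd
    rw [hey, he₀] at hye
    rcases Sym2.mem_iff.mp hye with h' | h'
    · exact hy3 h'
    · exact hyv h'

/-- **THE CORES ARE TWO-CONNECTED**: on `WReducedI` with `a₃` not a leaf, for every vertex `v`, two
non-isolated vertices other than `v` are connected in `G − v`. -/
theorem conn_sepConfig_of_core (h : WReducedI ends o a₁ a₂ a₃ b) (hd3 : nonLoopDeg ends a₃ ≠ 1)
    (h12 : a₁ ≠ a₂) (h13 : a₁ ≠ a₃) (h23 : a₂ ≠ a₃) (ho1 : o ≠ a₁) (ho2 : o ≠ a₂) (ho3 : o ≠ a₃)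
    (hob : o ≠ b) (hb1 : b ≠ a₁) (hb2 : b ≠ a₂) (hb3 : b ≠ a₃) {v x y : V} (hxv : x ≠ v)
    (hyv : y ≠ v) (hx : ∃ e, x ∈ ends e ∧ ¬ (ends e).IsDiag)
    (hy : ∃ e, y ∈ ends e ∧ ¬ (ends e).IsDiag) : Conn ends (sepConfig ends {v}) x y := by
  by_contra hxy
  obtain ⟨side, hcut, ⟨ex, hsx, hxd, -⟩, ⟨ey, hsy, hyd, -⟩⟩ :=
    exists_cut_of_not_conn_sepConfig ends hxv hyv hx hy hxy
  exact no_cutVertex_of_wredI_of_a3_not_leaf h hd3 hcut ⟨ex, hsx, hxd⟩ ⟨ey, hsy, hyd⟩ h12 h13 h23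
    ho1 ho2 ho3 hob hb1 hb2 hb3

end Main

end WRed

end Summit.Ventures.PercRepro2
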